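import Mathlib
import Summits.Ventures.HodgeRepro2.T5DegreeOnePadicInt

/-!
# T5DegreeOnePadic — the embedding `K →+* ℚ_[p]` at a degree-one prime, and the valuations agree

Tier-5 kernel support (seat p7), file (3) of the chain behind route/T5-LEAN-p7.md §22 (fourth
addendum), «the completion of `F` at a degree-one prime `𝔭` is `ℚ_p`». With `toPadicInt : R →+* ℤ_[p]`
of `T5DegreeOnePadicInt` in hand, the fraction field `K` of `R` embeds into `ℚ_[p]`
(`toPadic`, Mathlib's `IsFractionRing.lift`), with dense image (`ℚ` is dense in `ℚ_[p]`), and —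
the point of this file — THE VALUATIONS AGREE: the pull-back of the `p`-adic valuation
`Padic.mulValuation` of `ℚ_[p]` along `toPadic` IS the `w`-adic valuation `w.valuation K` of
Mathlib's `HeightOneSpectrum` (`comap_mulValuation_toPadic`), so that `‖toPadic x‖ = p ^ (-v_w(x))`
(`valuation_le_exp_iff`, `valuation_lt_exp_iff`). The completion statement is file (4).

Setting: `R` a Dedekind domain with fraction field `K`, `w : HeightOneSpectrum R`, `p` a rational
prime with `(p : R) ∈ w.asIdeal`, `(p : R) ∉ w.asIdeal ^ 2` (`e = 1`) and `ℤ → R ⧸ w.asIdeal`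
surjective (`f = 1`). Definitions: `toPadicOfInt`, `toPadic`. Two elementary lemmas on
`Padic.mulValuation` against the norm (`mulValuation_le_exp_iff`, `mulValuation_lt_exp_iff`) and
one on the discrete value group `ℤᵐ⁰` (`eq_of_forall_le_exp_neg_iff`) are included.
-/

namespace Summit.Ventures.HodgeRepro2.T5DegreeOnePadic

open Ideal IsDedekindDomain WithZero
open Summit.Ventures.HodgeRepro2.T5DegreeOneQuotient Summit.Ventures.HodgeRepro2.T5DegreeOnePadicInt

section Discrete

variable {p : ℕ} [hp : Fact p.Prime]

/-- `Padic.mulValuation y ≤ exp n ↔ ‖y‖ ≤ p ^ n`. -/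
theorem mulValuation_le_exp_iff (y : ℚ_[p]) (n : ℤ) :
    Padic.mulValuation y ≤ exp n ↔ ‖y‖ ≤ (p : ℝ) ^ n := by
  by_cases hy : y = 0
  · subst hy
    simp only [map_zero, norm_zero]
    exact ⟨fun _ => zpow_nonneg (Nat.cast_nonneg _) _, fun _ => zero_le⟩
  · have hu : Padic.mulValuation y ≠ 0 := (map_ne_zero _).mpr hy
    rw [Padic.norm_eq_zpow_log_mulValuation hy,
      zpow_le_zpow_iff_right₀ (by exact_mod_cast hp.out.one_lt), log_le_iff_le_exp hu]

/-- `Padic.mulValuation y < exp n ↔ ‖y‖ < p ^ n`. -/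
theorem mulValuation_lt_exp_iff (y : ℚ_[p]) (n : ℤ) :
    Padic.mulValuation y < exp n ↔ ‖y‖ < (p : ℝ) ^ n := by
  by_cases hy : y = 0
  · subst hy
    simp only [map_zero, norm_zero]
    exact ⟨fun _ => zpow_pos (by exact_mod_cast hp.out.pos) _, fun _ => exp_pos⟩
  · have hu : Padic.mulValuation y ≠ 0 := (map_ne_zero _).mpr hy
    rw [Padic.norm_eq_zpow_log_mulValuation hy,
      zpow_lt_zpow_iff_right₀ (by exact_mod_cast hp.out.one_lt), log_lt_iff_lt_exp hu]

omit hp in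
/-- Two elements `≤ 1` of the discrete value group `ℤᵐ⁰` that are bounded by the same `exp (-n)`
are equal. -/
theorem eq_of_forall_le_exp_neg_iff {u u' : ℤᵐ⁰} (hu : u ≤ 1) (hu' : u' ≤ 1)
    (h : ∀ n : ℕ, u ≤ exp (-(n : ℤ)) ↔ u' ≤ exp (-(n : ℤ))) : u = u' := by
  have key : ∀ {a b : ℤᵐ⁰}, a ≤ 1 → b ≤ 1 →
      (∀ n : ℕ, a ≤ exp (-(n : ℤ)) → b ≤ exp (-(n : ℤ))) → b ≤ a := by
    intro a b ha hb hab
    rcases eq_or_ne a 0 with rfl | ha0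
    · by_contra hne
      have hb0 : b ≠ 0 := fun h0 => hne (le_of_eq h0)
      have hlog : log b ≤ 0 := by
        rw [log_le_iff_le_exp hb0]
        simpa using hb
      have hbn := (log_le_iff_le_exp hb0).mpr (hab ((-log b).toNat + 1) zero_le)
      have ht := Int.toNat_of_nonneg (neg_nonneg.mpr hlog)
      push_cast at hbn
      rw [ht] at hbn
      omega
    · have hloga : log a ≤ 0 := by
        rw [log_le_iff_le_exp ha0]
        simpa using ha
      have ht := Int.toNat_of_nonneg (neg_nonneg.mpr hloga)
      have hbn := hab (-log a).toNat ((log_le_iff_le_exp ha0).mp (by rw [ht]; omega))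
      rw [ht, neg_neg] at hbn
      calc b ≤ exp (log a) := hbn
        _ = a := exp_log ha0
  exact le_antisymm (key hu' hu fun n => (h n).mpr) (key hu hu' fun n => (h n).mp)

end Discrete

variable {R : Type*} [CommRing R] [IsDedekindDomain R] {K : Type*} [Field K] [Algebra R K]
  [IsFractionRing R K] (w : HeightOneSpectrum R) {p : ℕ} [hp : Fact p.Prime]
  (hpP : (p : R) ∈ w.asIdeal) (hpP2 : (p : R) ∉ w.asIdeal ^ 2)
  (hsurj : ∀ x : R, ∃ a : ℤ, x - a ∈ w.asIdeal)
include hpP hpP2 hsurj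

/-- `R →+* ℚ_[p]`: `toPadicInt` followed by the inclusion `ℤ_[p] → ℚ_[p]`. -/
noncomputable def toPadicOfInt : R →+* ℚ_[p] :=
  PadicInt.Coe.ringHom.comp (toPadicInt w.ne_bot hpP hpP2 hsurj)

/-- `toPadicOfInt x` is `toPadicInt x` viewed in `ℚ_[p]`. -/
theorem toPadicOfInt_apply (x : R) :
    toPadicOfInt w hpP hpP2 hsurj x = (toPadicInt w.ne_bot hpP hpP2 hsurj x : ℚ_[p]) := rfl

/-- `toPadicOfInt` is injective. -/
theorem toPadicOfInt_injective : Function.Injective (toPadicOfInt w hpP hpP2 hsurj) := by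
  intro x y hxy
  exact toPadicInt_injective w.ne_bot hpP hpP2 hsurj (Subtype.val_injective hxy)

/-- THE EMBEDDING `K →+* ℚ_[p]` of the fraction field at a degree-one prime (Mathlib's
`IsFractionRing.lift` of `toPadicOfInt`). -/
noncomputable def toPadic : K →+* ℚ_[p] :=
  IsFractionRing.lift (toPadicOfInt_injective w hpP hpP2 hsurj)

/-- `toPadic` restricts to `toPadicInt` on `R`. -/
theorem toPadic_algebraMap (x : R) :
    toPadic w hpP hpP2 hsurj (algebraMap R K x) = (toPadicInt w.ne_bot hpP hpP2 hsurj x : ℚ_[p]) :=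
  IsFractionRing.lift_algebraMap _ _

/-- The norm of `toPadic` on `R` is the norm of `toPadicInt`. -/
theorem norm_toPadic_algebraMap (x : R) :
    ‖toPadic w hpP hpP2 hsurj (algebraMap R K x)‖ = ‖toPadicInt w.ne_bot hpP hpP2 hsurj x‖ := by
  rw [toPadic_algebraMap]
  rfl

/-- `toPadic` is injective (a ring map out of a field). -/
theorem toPadic_injective : Function.Injective (toPadic w hpP hpP2 hsurj (K := K)) :=
  RingHom.injective (toPadic w hpP hpP2 hsurj (K := K))

/-- `toPadic` is the identity on `ℚ`. -/
theorem toPadic_ratCast (q : ℚ) : toPadic w hpP hpP2 hsurj (q : K) = (q : ℚ_[p]) :=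
  map_ratCast _ q

/-- The range of `toPadic` is dense in `ℚ_[p]` (it contains `ℚ`, `Padic.denseRange_ratCast`). -/
theorem denseRange_toPadic : DenseRange (toPadic w hpP hpP2 hsurj (K := K)) := by
  have h : Set.range ((↑) : ℚ → ℚ_[p]) ⊆ Set.range (toPadic w hpP hpP2 hsurj (K := K)) := by
    rintro _ ⟨q, rfl⟩
    exact ⟨(q : K), map_ratCast _ q⟩
  exact Dense.mono h (Padic.denseRange_ratCast p)

/-- On `R`, the `p`-adic valuation of `toPadicInt a` is the `w`-adic valuation of `a`
(both are `≤ 1` and bounded by the same `exp (-n)`: `a ∈ w ^ n`). -/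
theorem mulValuation_toPadicInt (a : R) :
    Padic.mulValuation (toPadicInt w.ne_bot hpP hpP2 hsurj a : ℚ_[p]) = w.intValuation a := by
  apply eq_of_forall_le_exp_neg_iff
  · have := (mulValuation_le_exp_iff (toPadicInt w.ne_bot hpP hpP2 hsurj a : ℚ_[p]) 0).mpr
      (by rw [zpow_zero]; exact PadicInt.norm_le_one _)
    simpa using this
  · exact w.intValuation_le_one a
  · intro n
    rw [mulValuation_le_exp_iff, HeightOneSpectrum.intValuation_le_pow_iff_mem, ← PadicInt.norm_def,
      ← mem_pow_iff_norm_toPadicInt_le w.ne_bot hpP hpP2 hsurj n a]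

/-- On `R ⊆ K`, the `p`-adic valuation of `toPadic` is the `w`-adic valuation. -/
theorem mulValuation_toPadic_algebraMap (a : R) :
    Padic.mulValuation (toPadic w hpP hpP2 hsurj (algebraMap R K a)) =
      w.valuation K (algebraMap R K a) := by
  rw [toPadic_algebraMap, mulValuation_toPadicInt, HeightOneSpectrum.valuation_of_algebraMap]

/-- THE VALUATIONS AGREE: the pull-back of the `p`-adic valuation of `ℚ_[p]` along `toPadic` is
the `w`-adic valuation of `K`. -/
theorem comap_mulValuation_toPadic :
    (Padic.mulValuation (p := p)).comap (toPadic w hpP hpP2 hsurj (K := K)) = w.valuation K := by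
  ext x
  obtain ⟨a, b, _, rfl⟩ := IsFractionRing.div_surjective R x
  simp only [Valuation.comap_apply, map_div₀, mulValuation_toPadic_algebraMap]

/-- `w.valuation K x = Padic.mulValuation (toPadic x)`. -/
theorem valuation_eq_mulValuation_toPadic (x : K) :
    w.valuation K x = Padic.mulValuation (toPadic w hpP hpP2 hsurj x) := by
  rw [← comap_mulValuation_toPadic w hpP hpP2 hsurj, Valuation.comap_apply]

/-- `w.valuation K x ≤ exp n ↔ ‖toPadic x‖ ≤ p ^ n`. -/
theorem valuation_le_exp_iff (x : K) (n : ℤ) :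
    w.valuation K x ≤ exp n ↔ ‖toPadic w hpP hpP2 hsurj x‖ ≤ (p : ℝ) ^ n := by
  rw [valuation_eq_mulValuation_toPadic w hpP hpP2 hsurj, mulValuation_le_exp_iff]

/-- `w.valuation K x < exp n ↔ ‖toPadic x‖ < p ^ n`. -/
theorem valuation_lt_exp_iff (x : K) (n : ℤ) :
    w.valuation K x < exp n ↔ ‖toPadic w hpP hpP2 hsurj x‖ < (p : ℝ) ^ n := by
  rw [valuation_eq_mulValuation_toPadic w hpP hpP2 hsurj, mulValuation_lt_exp_iff]

/-- `‖toPadic x‖ = p ^ log (w.valuation K x)` for `x ≠ 0`: the norm is the `w`-adic absolute value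
normalised by `‖p‖ = p⁻¹`. -/
theorem norm_toPadic_eq_zpow_log (x : K) (hx : x ≠ 0) :
    ‖toPadic w hpP hpP2 hsurj x‖ = (p : ℝ) ^ (log (w.valuation K x)) := by
  rw [valuation_eq_mulValuation_toPadic w hpP hpP2 hsurj]
  exact Padic.norm_eq_zpow_log_mulValuation ((map_ne_zero _).mpr hx)

/-- `‖toPadic x‖ ≤ 1 ↔ w.valuation K x ≤ 1`: the `w`-integers of `K` map into `ℤ_[p]`. -/
theorem norm_toPadic_le_one_iff (x : K) :
    ‖toPadic w hpP hpP2 hsurj x‖ ≤ 1 ↔ w.valuation K x ≤ 1 := by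
  have := valuation_le_exp_iff w hpP hpP2 hsurj x 0
  rw [exp_zero, zpow_zero] at this
  exact this.symm

end Summit.Ventures.HodgeRepro2.T5DegreeOnePadic
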